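import Mathlib
import Summits.Ventures.PercRepro2.TypedA3PathRootEdge

/-!
# The root edge at `b` is worth nothing beside a type-2 path `a₁ – a₃ – b` (blind cell PercRepro2,
night-3 g18, 2026-08-28; `proofs/NIGHT3-CERT.md` §27.12) — the `b`-twin of
`TypedA3PathRootEdge.lean`

With `f = {a₁, a₃}` and `g = {b, a₃}` typed edges of type `2`, adding a NEW edge `e = {a₁, b}` of
type `1` does not change the typed base of `K₃` (`typedCount_root_edge_of_a3_path_b`): the same
mechanism with g14's `KBsym_st_eq_zero_of_two_b` (two copies with `b, a₃ ∈ C(a₁)`) in place of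
`KBsym_st_eq_zero_of_two_o`. With g14's `typedCount_eq_zero_of_triangle_b` the Bernstein row along
`e` beside the path is `(N, N, 0, 0)` — the equality corner of (ROOT-MONO-b). Own work; standard
axioms.
-/

namespace Summit.Ventures.PercRepro2

open UnionCluster

namespace CovForm

namespace Triangle

open OneTyped Untouched CoincRoot TypedRed

section Main

open Classical

variable {V : Type*} {E : Type*} [Fintype E] [DecidableEq E] {R : Type*} [Field R]
  [LinearOrder R] [IsStrictOrderedRing R]
variable (ends : E → Sym2 V) (o a₁ a₂ a₃ b : V)

omit [Fintype E] [DecidableEq E] [LinearOrder R] [IsStrictOrderedRing R] in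
/-- A copy carrying `f = {a₁, a₃}` and `g = {b, a₃}` has `b, a₃ ∈ C(a₁)`. -/
lemma conn_of_both_b {f g : E} (hf : ends f = s(a₁, a₃)) (hg : ends g = s(b, a₃)) (u : Config E)
    (huf : u f = true) (hug : u g = true) : Conn ends u a₁ b ∧ Conn ends u a₁ a₃ := by
  have c3 : Conn ends u a₁ a₃ := conn_of_openAdj ⟨f, huf, hf⟩
  have co : Conn ends u b a₃ := conn_of_openAdj ⟨g, hug, hg⟩
  exact ⟨conn_trans c3 (conn_symm co), c3⟩

omit [Fintype E] [LinearOrder R] [IsStrictOrderedRing R] in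
/-- A copy carrying `f` or `g` has `b, a₃ ∈ C(a₁)` once `e = {a₁, b}` is opened. -/
lemma conn_of_update_of_one_b {e f g : E} (he : ends e = s(a₁, b)) (hf : ends f = s(a₁, a₃))
    (hg : ends g = s(b, a₃)) (u : Config E) (h : u f = true ∨ u g = true) :
    Conn ends (Function.update u e true) a₁ b ∧ Conn ends (Function.update u e true) a₁ a₃ := by
  have ce : Conn ends (Function.update u e true) a₁ b :=
    conn_of_openAdj ⟨e, Function.update_self e true u, he⟩
  refine ⟨ce, ?_⟩
  rcases h with h | h
  · exact conn_mono (le_update_true u e) (conn_of_openAdj ⟨f, h, hf⟩)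
  · exact conn_trans ce (conn_mono (le_update_true u e) (conn_of_openAdj ⟨g, h, hg⟩))

omit [Fintype E] [DecidableEq E] [LinearOrder R] [IsStrictOrderedRing R] in
/-- `KBsym` vanishes when the first and the second copy carry `b, a₃ ∈ C(a₁)`. -/
lemma KBsym_st_eq_zero_of_two_b_12 (u v t : Config E) (hub : Conn ends u a₁ b)
    (hu3 : Conn ends u a₁ a₃) (hvb : Conn ends v a₁ b) (hv3 : Conn ends v a₁ a₃) :
    KBsym (st ends o a₁ a₂ a₃ b u) (st ends o a₁ a₂ a₃ b v) (st ends o a₁ a₂ a₃ b t) = 0 := by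
  rw [KBsym_comm_right, KBsym_comm_left]
  exact KBsym_st_eq_zero_of_two_b ends o a₁ a₂ a₃ b t u v hub hu3 hvb hv3

omit [Fintype E] [DecidableEq E] [LinearOrder R] [IsStrictOrderedRing R] in
/-- `KBsym` vanishes when the first and the third copy carry `b, a₃ ∈ C(a₁)`. -/
lemma KBsym_st_eq_zero_of_two_b_13 (u t v : Config E) (hub : Conn ends u a₁ b)
    (hu3 : Conn ends u a₁ a₃) (hvb : Conn ends v a₁ b) (hv3 : Conn ends v a₁ a₃) :
    KBsym (st ends o a₁ a₂ a₃ b u) (st ends o a₁ a₂ a₃ b t) (st ends o a₁ a₂ a₃ b v) = 0 := by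
  rw [KBsym_comm_left]
  exact KBsym_st_eq_zero_of_two_b ends o a₁ a₂ a₃ b t u v hub hu3 hvb hv3

omit [Fintype E] [LinearOrder R] [IsStrictOrderedRing R] in
/-- **The core pointwise identity**, the copy `x` carrying both `f` and `g`: the three placements of
the new edge `e` sum to the term without `e`. -/
lemma three_placements_eq_b {e f g : E} (he : ends e = s(a₁, b)) (hf : ends f = s(a₁, a₃))
    (hg : ends g = s(b, a₃)) (x y w : Config E) (hxf : x f = true) (hxg : x g = true)
    (hf2 : (x f).toNat + (y f).toNat + (w f).toNat = 2)
    (hg2 : (x g).toNat + (y g).toNat + (w g).toNat = 2) :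
    KBsym (st ends o a₁ a₂ a₃ b (Function.update x e true)) (st ends o a₁ a₂ a₃ b y)
        (st ends o a₁ a₂ a₃ b w) +
      KBsym (st ends o a₁ a₂ a₃ b x) (st ends o a₁ a₂ a₃ b (Function.update y e true))
        (st ends o a₁ a₂ a₃ b w) +
      KBsym (st ends o a₁ a₂ a₃ b x) (st ends o a₁ a₂ a₃ b y)
        (st ends o a₁ a₂ a₃ b (Function.update w e true)) =
      KBsym (st ends o a₁ a₂ a₃ b x) (st ends o a₁ a₂ a₃ b y) (st ends o a₁ a₂ a₃ b w) := by
  obtain ⟨hxb, hx3⟩ := conn_of_both_b ends a₁ a₃ b hf hg x hxf hxg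
  -- the placement in `x` changes nothing
  have h1 : st ends o a₁ a₂ a₃ b (Function.update x e true) = st ends o a₁ a₂ a₃ b x :=
    TwoTyped.st_update_true_of_conn ends o a₁ a₂ a₃ b he x hxb
  -- the placement in `y` vanishes
  have h2 : KBsym (st ends o a₁ a₂ a₃ b x) (st ends o a₁ a₂ a₃ b (Function.update y e true))
      (st ends o a₁ a₂ a₃ b w) = 0 := by
    cases hyf : y f <;> cases hyg : y g
    · -- `y` carries neither: `w` carries both
      have hw : w f = true ∧ w g = true := by
        rw [hxf, hyf] at hf2; rw [hxg, hyg] at hg2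
        cases hwf : w f <;> cases hwg : w g <;> simp_all
      obtain ⟨hwb, hw3⟩ := conn_of_both_b ends a₁ a₃ b hf hg w hw.1 hw.2
      exact KBsym_st_eq_zero_of_two_b_13 ends o a₁ a₂ a₃ b x _ w hxb hx3 hwb hw3
    · obtain ⟨hyb, hy3⟩ := conn_of_update_of_one_b ends a₁ a₃ b he hf hg y (Or.inr hyg)
      exact KBsym_st_eq_zero_of_two_b_12 ends o a₁ a₂ a₃ b x _ w hxb hx3 hyb hy3
    · obtain ⟨hyb, hy3⟩ := conn_of_update_of_one_b ends a₁ a₃ b he hf hg y (Or.inl hyf)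
      exact KBsym_st_eq_zero_of_two_b_12 ends o a₁ a₂ a₃ b x _ w hxb hx3 hyb hy3
    · obtain ⟨hyb, hy3⟩ := conn_of_update_of_one_b ends a₁ a₃ b he hf hg y (Or.inl hyf)
      exact KBsym_st_eq_zero_of_two_b_12 ends o a₁ a₂ a₃ b x _ w hxb hx3 hyb hy3
  -- the placement in `w` vanishes
  have h3 : KBsym (st ends o a₁ a₂ a₃ b x) (st ends o a₁ a₂ a₃ b y)
      (st ends o a₁ a₂ a₃ b (Function.update w e true)) = 0 := by
    cases hwf : w f <;> cases hwg : w g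
    · have hy : y f = true ∧ y g = true := by
        rw [hxf, hwf] at hf2; rw [hxg, hwg] at hg2
        cases hyf : y f <;> cases hyg : y g <;> simp_all
      obtain ⟨hyb, hy3⟩ := conn_of_both_b ends a₁ a₃ b hf hg y hy.1 hy.2
      exact KBsym_st_eq_zero_of_two_b_12 ends o a₁ a₂ a₃ b x y _ hxb hx3 hyb hy3
    · obtain ⟨hwb, hw3⟩ := conn_of_update_of_one_b ends a₁ a₃ b he hf hg w (Or.inr hwg)
      exact KBsym_st_eq_zero_of_two_b_13 ends o a₁ a₂ a₃ b x y _ hxb hx3 hwb hw3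
    · obtain ⟨hwb, hw3⟩ := conn_of_update_of_one_b ends a₁ a₃ b he hf hg w (Or.inl hwf)
      exact KBsym_st_eq_zero_of_two_b_13 ends o a₁ a₂ a₃ b x y _ hxb hx3 hwb hw3
    · obtain ⟨hwb, hw3⟩ := conn_of_update_of_one_b ends a₁ a₃ b he hf hg w (Or.inl hwf)
      exact KBsym_st_eq_zero_of_two_b_13 ends o a₁ a₂ a₃ b x y _ hxb hx3 hwb hw3
  rw [h1, h2, h3, add_zero, add_zero]

omit [Fintype E] [LinearOrder R] [IsStrictOrderedRing R] in
/-- The pointwise identity for any triple on the support (some copy carries both `f` and `g`). -/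
lemma three_placements_eq_b' {e f g : E} (he : ends e = s(a₁, b)) (hf : ends f = s(a₁, a₃))
    (hg : ends g = s(b, a₃)) (x y w : Config E)
    (hf2 : (x f).toNat + (y f).toNat + (w f).toNat = 2)
    (hg2 : (x g).toNat + (y g).toNat + (w g).toNat = 2) :
    KBsym (st ends o a₁ a₂ a₃ b (Function.update x e true)) (st ends o a₁ a₂ a₃ b y)
        (st ends o a₁ a₂ a₃ b w) +
      KBsym (st ends o a₁ a₂ a₃ b x) (st ends o a₁ a₂ a₃ b (Function.update y e true))
        (st ends o a₁ a₂ a₃ b w) +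
      KBsym (st ends o a₁ a₂ a₃ b x) (st ends o a₁ a₂ a₃ b y)
        (st ends o a₁ a₂ a₃ b (Function.update w e true)) =
      KBsym (st ends o a₁ a₂ a₃ b x) (st ends o a₁ a₂ a₃ b y) (st ends o a₁ a₂ a₃ b w) := by
  rcases some_copy_both hf2 hg2 with ⟨hxf, hxg⟩ | ⟨hyf, hyg⟩ | ⟨hwf, hwg⟩
  · exact three_placements_eq_b ends o a₁ a₂ a₃ b he hf hg x y w hxf hxg hf2 hg2
  · have h := three_placements_eq_b ends o a₁ a₂ a₃ b he hf hg y x w hyf hyg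
      (by rw [← hf2]; ring) (by rw [← hg2]; ring)
    rw [KBsym_comm_left (st ends o a₁ a₂ a₃ b (Function.update y e true)),
      KBsym_comm_left (st ends o a₁ a₂ a₃ b y) (st ends o a₁ a₂ a₃ b (Function.update x e true)),
      KBsym_comm_left (st ends o a₁ a₂ a₃ b y) (st ends o a₁ a₂ a₃ b x)
        (st ends o a₁ a₂ a₃ b (Function.update w e true)),
      KBsym_comm_left (st ends o a₁ a₂ a₃ b y) (st ends o a₁ a₂ a₃ b x)] at h
    linarith
  · have h := three_placements_eq_b ends o a₁ a₂ a₃ b he hf hg w y x hwf hwg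
      (by rw [← hf2]; ring) (by rw [← hg2]; ring)
    -- swap the first and third slots
    have s : ∀ p q r : St, KBsym p q r = KBsym r q p := by
      intro p q r
      rw [KBsym_comm_left, KBsym_comm_right, KBsym_comm_left]
    rw [s (st ends o a₁ a₂ a₃ b (Function.update w e true)),
      s (st ends o a₁ a₂ a₃ b w) (st ends o a₁ a₂ a₃ b (Function.update y e true)),
      s (st ends o a₁ a₂ a₃ b w) (st ends o a₁ a₂ a₃ b y)
        (st ends o a₁ a₂ a₃ b (Function.update x e true)),
      s (st ends o a₁ a₂ a₃ b w) (st ends o a₁ a₂ a₃ b y)] at h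
    linarith

/-- **The root edge at `b` beside a type-2 path `a₁ – a₃ – b` is worth nothing**: with
`f = {a₁, a₃}` and `g = {b, a₃}` in `F` of type `2`, adding the new edge `e = {a₁, b}` of type `1`
leaves the typed base unchanged. -/
theorem typedCount_root_edge_of_a3_path_b {e f g : E} (he : ends e = s(a₁, b))
    (hf : ends f = s(a₁, a₃)) (hg : ends g = s(b, a₃)) (F : Finset E) (heF : e ∉ F) (hfF : f ∈ F)
    (hgF : g ∈ F) (z : Config E) (hze : z e = false) (τ : E → ℕ)
    (hτ : ∀ e' ∈ F, τ e' = 1 ∨ τ e' = 2) (hτf : τ f = 2) (hτg : τ g = 2) :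
    typedCount (insert e F) z (Function.update τ e 1)
        (K3 ends o a₁ a₂ a₃ b : Config E → Config E → Config E → R) =
      typedCount F z τ (K3 ends o a₁ a₂ a₃ b) := by
  have hτ' : ∀ e' ∈ insert e F, Function.update τ e 1 e' = 1 ∨ Function.update τ e 1 e' = 2 := by
    intro e' he'
    rcases Finset.mem_insert.1 he' with rfl | he'
    · left; exact Function.update_self _ _ _
    · rw [Function.update_of_ne (fun h => heF (by rw [← h]; exact he'))]
      exact hτ e' he'
  have hcτ : ∀ K : Config E → Config E → Config E → R,
      typedCount F z (Function.update τ e 1) K = typedCount F z τ K := fun K =>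
    typedCount_congr_τ F z (fun e' he' => Function.update_of_ne (fun h => heF (by rw [← h]; exact he')) _ _) K
  have h6L := six_mul_typedCount_KBsym'' (R := R) ends o a₁ a₂ a₃ b (insert e F) z
    (Function.update τ e 1) hτ'
  have h6R := six_mul_typedCount_KBsym'' (R := R) ends o a₁ a₂ a₃ b F z τ hτ
  set KS : Config E → Config E → Config E → R := fun x y w =>
    ((KBsym (st ends o a₁ a₂ a₃ b x) (st ends o a₁ a₂ a₃ b y) (st ends o a₁ a₂ a₃ b w) : ℤ) : R)
    with hKS
  have hsplit := typedCount_split (insert e F) e (Finset.mem_insert_self e F) z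
    (Function.update τ e 1) KS
  have hz : Function.update z e false = z := by
    rw [← hze]; exact Function.update_eq_self e z
  rw [Function.update_self, Finset.erase_insert heF, hz, sum_bool3_one_rp, hcτ, hcτ, hcτ,
    ← TypedRed.typedCount_add, ← TypedRed.typedCount_add] at hsplit
  -- the pointwise identity on the support of the right count
  have hpt : typedCount F z τ (fun x y w =>
      KS (Function.update x e true) (Function.update y e false) (Function.update w e false) +
      KS (Function.update x e false) (Function.update y e true) (Function.update w e false) +
      KS (Function.update x e false) (Function.update y e false) (Function.update w e true)) =
      typedCount F z τ KS := by
    refine typedCount_congr_on_support F z τ fun x y w hoff hτ'' => ?_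
    have hx : Function.update x e false = x := by
      have h : x e = false := (hoff e heF).1.trans hze
      rw [← h]; exact Function.update_eq_self e x
    have hy : Function.update y e false = y := by
      have h : y e = false := (hoff e heF).2.1.trans hze
      rw [← h]; exact Function.update_eq_self e y
    have hw : Function.update w e false = w := by
      have h : w e = false := (hoff e heF).2.2.trans hze
      rw [← h]; exact Function.update_eq_self e w
    rw [hx, hy, hw]
    have hf2 := hτ'' f hfF
    have hg2 := hτ'' g hgF
    rw [hτf] at hf2
    rw [hτg] at hg2
    unfold openCount at hf2 hg2
    have := three_placements_eq_b' ends o a₁ a₂ a₃ b he hf hg x y w hf2 hg2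
    simp only [hKS]
    exact_mod_cast this
  rw [hpt] at hsplit
  rw [hsplit, ← h6R] at h6L
  have h6' : (6 : R) ≠ 0 := by norm_num
  exact mul_left_cancel₀ h6' h6L

end Main

end Triangle

end CovForm

end Summit.Ventures.PercRepro2
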